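/-
COR-CM (cell pub-hodgecm2 = stage 2 of the Hodge ladder), binder seat b14 (prover-pub-hodgecm2-b14-g4-0, 2026-08-20):
the PERIOD-FREE SHADOW argument IN THE TREE — `PeriodThmF` (the hypothesis `PerLFace` of `HC_CM_of_PerLFace`) is
independent of the 28 model facts and of the conclusions `HC_CM` / `W_RK4`, at the level of abstract universes.
Tree counterpart of the stage-1 package's kernel file `HodgeCM/Model/PeriodFree.lean` (there phrased with a definition
`Universe.periodFree`; here DEFINITION-FREE: the shadow universe is built inside the proof of the existence theorem, and
the vanishing lemmas are stated for any universe with identically zero trace).  Theorems only.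
-/
import Summits.HodgeConjecture.CorCM.Geometry.Facts
import Summits.HodgeConjecture.CorCM.Geometry.NonVacuity
import HarnessLib

/-!
# The period-free shadow: `PeriodThmF` is not a consequence of the model facts, nor of `HC_CM`

For a geometric universe `U` (`CorCM/Geometry/Universe.lean`) consider the universe `U'` with the SAME varieties,
cohomology, Hodge structures, algebraic classes, morphisms, products, CM data and Picard modular surfaces, but trace
`tr := 0`.  Then (all kernel, no hypothesis on `U` beyond the named ones):

* `trC_eq_zero_of_tr`, `period_eq_zero_of_tr` — on a universe with zero trace every quadrilinear period vanishes, so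
  `PeriodNV` fails for EVERY datum (`not_periodNV_of_tr`), hence `PerL44` and `PeriodThmF` fail as soon as their binder
  prefixes are inhabited — for `PeriodThmF` they are (`periodThmF_binders_inhabited`, `F = ℚ(ζ₇)`:
  `not_periodThmF_of_tr`), and `SurfaceCriterion` holds vacuously (`surfaceCriterion_of_tr`);
* `exists_shadow` — for every `U` there is such a `U'` with: `U'.ModelAxioms` if `U.ModelAxioms` (only `Fact_tr_degree`,
  `Fact_gysin_surface`, `Fact_deg_diag` mention the trace, and each holds trivially for `tr = 0`), LITERALLY the same
  `HC_CM`, `HC`, `W_RK4`, `WeilFaceAlgebraic`, `FaceReduction`, `Lemma81` (these do not mention the trace), `SurfaceCriterion`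
  true, and `PeriodThmF` false, `PeriodNV` false for every datum.

CONSEQUENCES (the independence statements a referee can cite; all over abstract universes):
* `not_forall_modelAxioms_imp_periodThmF` — if `U.ModelAxioms → U.PeriodThmF` held for every universe, then NO universe
  would satisfy the model facts: the face-form period theorem is not derivable from the 28 model facts (relative to their
  consistency);
* `not_forall_hc_cm_imp_periodThmF` — if `U.ModelAxioms → U.HC_CM → U.PeriodThmF` held for every universe, then `HC_CM`
  would FAIL on every universe satisfying the model facts: the hypothesis `PerLFace := PeriodThmF` of the stage-2 target
  is not implied by its conclusion (uniformly in the model facts) unless that conclusion is refutable on all models;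
* likewise with `W_RK4` (`not_forall_w_rk4_imp_periodThmF`).

What this does NOT say: anything about `PeriodThmF` on the INTENDED universe `Model.picardCMUniverse …` (its trace is the
Betti trace, not zero) — that is the open period theorem itself (stage 1 / binder B01 of HOME/BINDER-OWNERS.md).
-/

noncomputable section

open scoped TensorProduct

namespace Summit.HodgeConjecture.CorCM

open Literature.AlgebraicGeometry.Motives (CMType)

namespace Universe

variable (U : Universe)

/-! ### Universes with zero trace: all periods vanish -/

/-- On a universe with identically zero trace the complexified trace vanishes. -/
theorem trC_eq_zero_of_tr (h0 : ∀ (X : U.Var) (k : ℕ), U.tr X k = 0) (X : U.Var) (k : ℕ) : U.trC X k = 0 := by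
  change (TensorProduct.AlgebraTensorModule.rid ℚ ℂ ℂ).toLinearMap ∘ₗ (U.tr X k).baseChange ℂ = 0
  rw [h0, LinearMap.baseChange_zero, LinearMap.comp_zero]

/-- On a universe with identically zero trace every quadrilinear period `∫_X ω₁ ∧ ω₂ ∧ \overline{ω₃ ∧ ω₄}` vanishes. -/
theorem period_eq_zero_of_tr (h0 : ∀ (X : U.Var) (k : ℕ), U.tr X k = 0) (X : U.Var) (ω : Fin 4 → U.CohC X 1) :
    U.period X ω = 0 := by
  change U.trC X 4 _ = 0
  rw [U.trC_eq_zero_of_tr h0, LinearMap.zero_apply]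

/-- On a universe with identically zero trace the conclusion shape `PeriodNV` of PerL Thm 4.4 / rfwf Thm 4.1 is FALSE
for every datum `(ι₁, V, K, Ψ, σ)`. -/
theorem not_periodNV_of_tr (h0 : ∀ (X : U.Var) (k : ℕ), U.tr X k = 0) {L : CMField} (ι₁ : L →+* ℂ)
    (V : HermSpace3 L ι₁) (K : CMField) (Ψ : Fin 4 → CMType K) (σ : K →+* ℂ) : ¬ U.PeriodNV ι₁ V K Ψ σ := by
  rintro ⟨Γ, F, α, -, hne⟩
  exact hne (U.period_eq_zero_of_tr h0 _ _)

/-- On a universe with identically zero trace the face-form period theorem `PeriodThmF` is FALSE (its binder prefix is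
inhabited: `periodThmF_binders_inhabited`, `F = ℚ(ζ₇)`). -/
theorem not_periodThmF_of_tr (h0 : ∀ (X : U.Var) (k : ℕ), U.tr X k = 0) : ¬ U.PeriodThmF := by
  intro h
  obtain ⟨F, hG, h6, f, ι₁, hf, V, hNV⟩ := U.exists_periodNV_of_periodThmF h
  exact U.not_periodNV_of_tr h0 ι₁ V F f.psi ι₁ hNV

/-- On a universe with identically zero trace PerL Thm 4.4 (`PerL44`, `∀ V`-form) FAILS for every admissible sextic datum:
it holds only if its binder prefix is uninhabited. -/
theorem perL44_imp_of_tr (h0 : ∀ (X : U.Var) (k : ℕ), U.tr X k = 0) (h : U.PerL44)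
    (K L : CMField) (j : K →+* L) (hN : IsNormalClosure ℚ K L) (hK : Module.finrank ℚ K = 6)
    (hL : Module.finrank ℚ L = 24 ∨ Module.finrank ℚ L = 48) (φ : Fin 3 → (K →+* ℂ)) (hφ : IsFrame φ)
    (ι₁ : L →+* ℂ) (hι : ι₁.comp j = φ 0) (t : Fin 4 → CMType K) (ht : IsPerLTypes φ t) : False := by
  obtain ⟨V⟩ := landherr_exists_proof L ι₁
  exact U.not_periodNV_of_tr h0 ι₁ V K t (φ 0) (h K L j hN hK hL φ hφ ι₁ hι t ht V)

/-- On a universe with identically zero trace the surface criterion (rfwf Prop 2.2) holds VACUOUSLY. -/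
theorem surfaceCriterion_of_tr (h0 : ∀ (X : U.Var) (k : ℕ), U.tr X k = 0) : U.SurfaceCriterion := by
  intro F _ f ι₁ _ S _ Fm α _ hne
  exact absurd (U.period_eq_zero_of_tr h0 _ _) hne

/-! ### Changing the trace does not change the trace-free statements -/

section TraceUpdate

variable (t : ∀ (X : U.Var) (k : ℕ), U.Coh X k →ₗ[ℚ] ℚ)

/-- `HC_CM` does not mention the trace: it is literally the same statement on `U` and on `U` with any other trace. -/
theorem hc_cm_iff_of_tr_eq : ({ U with tr := t } : Universe).HC_CM ↔ U.HC_CM := Iff.rfl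

/-- `HC X` does not mention the trace. -/
theorem hc_iff_of_tr_eq (X : U.Var) : ({ U with tr := t } : Universe).HC X ↔ U.HC X := Iff.rfl

/-- `WeilFaceAlgebraic` does not mention the trace. -/
theorem weilFaceAlgebraic_iff_of_tr_eq (K : CMField) (f : Face K) :
    ({ U with tr := t } : Universe).WeilFaceAlgebraic K f ↔ U.WeilFaceAlgebraic K f := Iff.rfl

/-- `W_RK4` does not mention the trace. -/
theorem w_rk4_iff_of_tr_eq : ({ U with tr := t } : Universe).W_RK4 ↔ U.W_RK4 := Iff.rfl

/- `cmProd F Θ = prodFin n …` is defined by structural recursion on `n`; with `n` a variable the elaborator's smart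
unfolding refuses to unfold it, so the literal identities below are checked with `smartUnfolding false` (the kernel
comparison is the plain structural one) — as in the package file `HodgeCM/Model/PeriodFree.lean`. -/

set_option smartUnfolding false in
/-- `FaceReduction` does not mention the trace. -/
theorem faceReduction_iff_of_tr_eq : ({ U with tr := t } : Universe).FaceReduction ↔ U.FaceReduction := Iff.rfl

set_option smartUnfolding false in
/-- `Lemma81` (rfwf Lemma 8.2) does not mention the trace. -/
theorem lemma81_iff_of_tr_eq : ({ U with tr := t } : Universe).Lemma81 ↔ U.Lemma81 := Iff.rfl

set_option smartUnfolding false in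
/-- `Fact_cmDominated` does not mention the trace. -/
theorem fact_cmDominated_iff_of_tr_eq :
    ({ U with tr := t } : Universe).Fact_cmDominated ↔ U.Fact_cmDominated := Iff.rfl

end TraceUpdate

/-- **The 28 model facts survive the passage to trace zero**: only `Fact_tr_degree`, `Fact_gysin_surface` and
`Fact_deg_diag` mention the trace, and each holds trivially for `tr = 0`. -/
theorem modelAxioms_of_tr_zero (M : U.ModelAxioms) : ({ U with tr := fun _ _ => 0 } : Universe).ModelAxioms where
  pull_id := M.pull_id
  pull_comp := M.pull_comp
  pull_cup := M.pull_cup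
  pull_hodge := M.pull_hodge
  cup2_hodge := M.cup2_hodge
  tr_degree := fun _ _ _ => rfl
  alg_le_hodge := M.alg_le_hodge
  pull_alg := M.pull_alg
  cup_alg := M.cup_alg
  lefschetz11 := M.lefschetz11
  cmAV := M.cmAV
  eigenLine := M.eigenLine
  alphaLine := M.alphaLine
  cmDominated := (U.fact_cmDominated_iff_of_tr_eq _).mpr M.cmDominated
  weilLine_rank := M.weilLine_rank
  weilLine_hodge := M.weilLine_hodge
  pms_dim := M.pms_dim
  lift := M.lift
  cup_comm1 := M.cup_comm1
  cup_interchange := M.cup_interchange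
  kunneth1 := M.kunneth1
  H1_rank := M.H1_rank
  H4_span := M.H4_span
  cmEnd := M.cmEnd
  conjIsogeny := M.conjIsogeny
  gysin_surface := fun S X f _ => ⟨0, Submodule.zero_mem _, fun _ => rfl⟩
  deg_diag := fun K Φ a Mm _ k => by
    change (0 : U.Coh _ k →ₗ[ℚ] ℚ) ∘ₗ U.pull Mm k = ((Algebra.norm ℚ a) ^ 4) • (0 : U.Coh _ k →ₗ[ℚ] ℚ)
    rw [LinearMap.zero_comp, smul_zero]
  algDuality := M.algDuality

/-! ### The shadow universe -/

/-- **The period-free shadow.** For every universe `U` there is a universe `U'` — same varieties, cohomology, Hodge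
structures, algebraic classes, morphisms, products, CM data, Picard modular surfaces; trace zero — such that:
the 28 model facts transfer (`U.ModelAxioms → U'.ModelAxioms`), the statements `HC_CM`, `W_RK4`, `FaceReduction`,
`Lemma81` are literally those of `U`, `SurfaceCriterion` holds, and `PeriodThmF` and every `PeriodNV` FAIL. -/
theorem exists_shadow :
    ∃ U' : Universe,
      (U.ModelAxioms → U'.ModelAxioms) ∧ (U'.HC_CM ↔ U.HC_CM) ∧ (U'.W_RK4 ↔ U.W_RK4) ∧
      (U'.FaceReduction ↔ U.FaceReduction) ∧ (U'.Lemma81 ↔ U.Lemma81) ∧ U'.SurfaceCriterion ∧ ¬ U'.PeriodThmF ∧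
      (∀ {L : CMField} (ι₁ : L →+* ℂ) (V : HermSpace3 L ι₁) (K : CMField) (Ψ : Fin 4 → CMType K) (σ : K →+* ℂ),
        ¬ U'.PeriodNV ι₁ V K Ψ σ) :=
  have h0 : ∀ (X : ({ U with tr := fun _ _ => 0 } : Universe).Var) (k : ℕ),
      ({ U with tr := fun _ _ => 0 } : Universe).tr X k = 0 := fun _ _ => rfl
  ⟨{ U with tr := fun _ _ => 0 }, U.modelAxioms_of_tr_zero, U.hc_cm_iff_of_tr_eq _, U.w_rk4_iff_of_tr_eq _,
    U.faceReduction_iff_of_tr_eq _, U.lemma81_iff_of_tr_eq _, surfaceCriterion_of_tr _ h0, not_periodThmF_of_tr _ h0,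
    fun ι₁ V K Ψ σ => not_periodNV_of_tr _ h0 ι₁ V K Ψ σ⟩

/-! ### Independence statements -/

/-- **`PeriodThmF` is not a consequence of the 28 model facts** (relative to their consistency): if
`U.ModelAxioms → U.PeriodThmF` held for every universe `U`, no universe would satisfy the model facts. -/
theorem not_forall_modelAxioms_imp_periodThmF (h : ∀ U : Universe, U.ModelAxioms → U.PeriodThmF) (U : Universe) :
    ¬ U.ModelAxioms := by
  intro M
  obtain ⟨U', hM, -, -, -, -, -, hF, -⟩ := U.exists_shadow
  exact hF (h U' (hM M))

/-- **`HC_CM` does not entail `PeriodThmF`** (uniformly in the model facts): if `U.ModelAxioms → U.HC_CM → U.PeriodThmF`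
held for every universe, then `HC_CM` would fail on every universe satisfying the model facts.  So the hypothesis
`PerLFace := PeriodThmF` of `HC_CM_of_PerLFace` is not recoverable from its conclusion. -/
theorem not_forall_hc_cm_imp_periodThmF (h : ∀ U : Universe, U.ModelAxioms → U.HC_CM → U.PeriodThmF)
    (U : Universe) (M : U.ModelAxioms) : ¬ U.HC_CM := by
  intro hc
  obtain ⟨U', hM, hHC, -, -, -, -, hF, -⟩ := U.exists_shadow
  exact hF (h U' (hM M) (hHC.mpr hc))

/-- **`W_RK4` does not entail `PeriodThmF`** (uniformly in the model facts): if `U.ModelAxioms → U.W_RK4 → U.PeriodThmF`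
held for every universe, then `W_RK4` would fail on every universe satisfying the model facts. -/
theorem not_forall_w_rk4_imp_periodThmF (h : ∀ U : Universe, U.ModelAxioms → U.W_RK4 → U.PeriodThmF)
    (U : Universe) (M : U.ModelAxioms) : ¬ U.W_RK4 := by
  intro hw
  obtain ⟨U', hM, -, hW, -, -, -, hF, -⟩ := U.exists_shadow
  exact hF (h U' (hM M) (hW.mpr hw))

/-- **The surface criterion does not entail `PeriodThmF`** either: if `U.ModelAxioms → U.SurfaceCriterion → U.PeriodThmF`
held for every universe, no universe would satisfy the model facts (the shadow satisfies the criterion vacuously). -/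
theorem not_forall_surfaceCriterion_imp_periodThmF
    (h : ∀ U : Universe, U.ModelAxioms → U.SurfaceCriterion → U.PeriodThmF) (U : Universe) : ¬ U.ModelAxioms := by
  intro M
  obtain ⟨U', hM, -, -, -, -, hS, hF, -⟩ := U.exists_shadow
  exact hF (h U' (hM M) hS)

end Universe

end Summit.HodgeConjecture.CorCM

end
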